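import Summits.ValiantsHypothesis.ValiantsHypothesis.Theorems.LacunarySymmetroidMatrixDescartesCensusExteriorTangentPencil
import Summits.ValiantsHypothesis.ValiantsHypothesis.Theorems.SymmetroidPencilBasics

/-!
# `MatrixDescartes` census — the EXTERIOR-TANGENT LAW, part IV: MATRIX FORM FROM ROOT DATA (both cap types)

HONEST FRAMING.  Object-search cell `pub-symmetroid`, door-A seat `val-sym-door-p1` (g13); helper beside the OPEN typed statements
`DoorA26 = PosRootLawAt 2 6 19` (stmt-ValiantsHypothesis-19979) and `DoorA34` (19980), asserted nowhere.  Consumer form of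
`…CensusExteriorTangentPencil.exteriorTangent_pencil` for certificate writers, in the currency they hold (`Census.twenty_midpoints`,
`Census.root_structure_of_twenty`): a symmetric `2 × 2` pencil `F(x) = Σ_l x^{d_l} • S_l` of ANY length on ANY support, two consecutive
positive det-roots `α < β` (`det F(α) = det F(β) = 0`, no det-root strictly between), ONE interior point where `det F < 0` (the gap is
indefinite), and `tr F(α) · tr F(β) > 0` (the two boundary rank-one matrices have the SAME type — a return excursion; positive OR negative
type).  Conclusion (`exteriorTangent_matrix`): a point `x₀ ∈ (α, β)` with, for the matrices `F₀ = F(x₀)` and `E₀ = E(x₀)`,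
`E(x) = Σ_l (d_l x^{d_l}) • S_l = x F'(x)` the Euler pencil:

* `det(E₀ − μ F₀) · tr² F₀ ≤ det F₀ · tr²(E₀ − μ F₀)` for every real `μ`;
* `det(E₀ − μ F₀) ≤ 0` for every real `μ` (no definite matrix on the tangent line);
* `D² ≤ 4 · det F₀ · det E₀` with `D = F₀₀₀E₀₁₁ + F₀₁₁E₀₀₀ − 2 F₀₀₁E₀₀₁ = x₀ f'(x₀)` (the quadratic row `(x f')² ≤ 4 f g`);
* `det F₀ < 0` and `det E₀ ≤ 0`.

The negative-type case is reduced to the positive one by `S ↦ −S` (every row is invariant).  Nothing here bounds `ζ_sym(2,6)`/`ζ_sym(3,4)`,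
decides `DoorA26`/`DoorA34`, or bears on `MatrixDescartes` (stmt-ValiantsHypothesis-18050) / `VP ≠ VNP`.

[folklore] Intermediate value theorem for the sign of `det F` on a root-free gap; bookkeeping over the companion theorem.
-/

-- `Summit.ValiantsHypothesis.ValiantsHypothesis.…` repeats a component by the D-0017 layout
-- (single-conjunct summit), which the `dupNamespace` linter flags; the name is mandated.
set_option linter.dupNamespace false

namespace Summit.ValiantsHypothesis.ValiantsHypothesis.Theorems.LacunarySymmetroidMatrixDescartes.Census

open Set Finset
open scoped BigOperators Topology

section Roots

variable {K : ℕ}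

/-- Determinant of the evaluated Euler pencil in entry sums (symmetric letters). [folklore] -/
theorem det_eulerPencilTwo (d : Fin K → ℕ) (S : Fin K → Matrix (Fin 2) (Fin 2) ℝ) (hS : ∀ l, (S l).IsSymm) (x : ℝ) :
    (∑ l, ((d l : ℝ) * x ^ d l) • S l).det
      = (∑ l, (d l : ℝ) * x ^ d l * S l 0 0) * (∑ l, (d l : ℝ) * x ^ d l * S l 1 1)
        - (∑ l, (d l : ℝ) * x ^ d l * S l 0 1) ^ 2 := by
  have h10 : ∀ l, S l 1 0 = S l 0 1 := fun l => by
    have := (hS l).apply 0 1; simpa using this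
  rw [Matrix.det_fin_two, eulerPencilTwo_apply, eulerPencilTwo_apply, eulerPencilTwo_apply, eulerPencilTwo_apply]
  simp only [h10]
  ring

/-- Determinant of `E − μ F` in entry sums (symmetric letters). [folklore] -/
theorem det_eulerPencilTwo_sub_smul (d : Fin K → ℕ) (S : Fin K → Matrix (Fin 2) (Fin 2) ℝ) (hS : ∀ l, (S l).IsSymm) (x μ : ℝ) :
    ((∑ l, ((d l : ℝ) * x ^ d l) • S l) - μ • (∑ l, x ^ d l • S l)).det
      = ((∑ l, (d l : ℝ) * x ^ d l * S l 0 0) - μ * (∑ l, x ^ d l * S l 0 0))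
          * ((∑ l, (d l : ℝ) * x ^ d l * S l 1 1) - μ * (∑ l, x ^ d l * S l 1 1))
        - ((∑ l, (d l : ℝ) * x ^ d l * S l 0 1) - μ * (∑ l, x ^ d l * S l 0 1)) ^ 2 := by
  have h10 : ∀ l, S l 1 0 = S l 0 1 := fun l => by
    have := (hS l).apply 0 1; simpa using this
  rw [Matrix.det_fin_two]
  simp only [Matrix.sub_apply, Matrix.smul_apply, eulerPencilTwo_apply, pencilTwo_apply, smul_eq_mul, h10]
  ring

/-- Trace of `E − μ F` in entry sums. [folklore] -/
theorem trace_eulerPencilTwo_sub_smul (d : Fin K → ℕ) (S : Fin K → Matrix (Fin 2) (Fin 2) ℝ) (x μ : ℝ) :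
    ((∑ l, ((d l : ℝ) * x ^ d l) • S l) - μ • (∑ l, x ^ d l • S l)).trace
      = ((∑ l, (d l : ℝ) * x ^ d l * S l 0 0) + (∑ l, (d l : ℝ) * x ^ d l * S l 1 1))
        - μ * ((∑ l, x ^ d l * S l 0 0) + (∑ l, x ^ d l * S l 1 1)) := by
  rw [Matrix.trace_sub, Matrix.trace_smul, Matrix.trace_fin_two, Matrix.trace_fin_two,
    eulerPencilTwo_apply, eulerPencilTwo_apply, pencilTwo_apply, pencilTwo_apply, smul_eq_mul]

/-- The entry-level law for a return excursion between NEGATIVE-definite gaps (`tr F(α), tr F(β) < 0`), by `S ↦ −S`. [folklore] -/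
theorem exteriorTangent_pencil_neg (d : Fin K → ℕ) (S : Fin K → Matrix (Fin 2) (Fin 2) ℝ) {α β : ℝ} (hα : 0 < α) (hαβ : α < β)
    (hfα : (∑ l, α ^ d l * S l 0 0) * (∑ l, α ^ d l * S l 1 1) - (∑ l, α ^ d l * S l 0 1) ^ 2 = 0)
    (hfβ : (∑ l, β ^ d l * S l 0 0) * (∑ l, β ^ d l * S l 1 1) - (∑ l, β ^ d l * S l 0 1) ^ 2 = 0)
    (hneg : ∀ x ∈ Ioo α β, (∑ l, x ^ d l * S l 0 0) * (∑ l, x ^ d l * S l 1 1) - (∑ l, x ^ d l * S l 0 1) ^ 2 < 0)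
    (hTα : (∑ l, α ^ d l * S l 0 0) + (∑ l, α ^ d l * S l 1 1) < 0)
    (hTβ : (∑ l, β ^ d l * S l 0 0) + (∑ l, β ^ d l * S l 1 1) < 0) :
    ∃ x₀ ∈ Ioo α β,
      (∀ μ : ℝ,
        (((∑ l, (d l : ℝ) * x₀ ^ d l * S l 0 0) - μ * (∑ l, x₀ ^ d l * S l 0 0))
            * ((∑ l, (d l : ℝ) * x₀ ^ d l * S l 1 1) - μ * (∑ l, x₀ ^ d l * S l 1 1))
          - ((∑ l, (d l : ℝ) * x₀ ^ d l * S l 0 1) - μ * (∑ l, x₀ ^ d l * S l 0 1)) ^ 2)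
          * ((∑ l, x₀ ^ d l * S l 0 0) + (∑ l, x₀ ^ d l * S l 1 1)) ^ 2
        ≤ ((∑ l, x₀ ^ d l * S l 0 0) * (∑ l, x₀ ^ d l * S l 1 1) - (∑ l, x₀ ^ d l * S l 0 1) ^ 2)
          * (((∑ l, (d l : ℝ) * x₀ ^ d l * S l 0 0) + (∑ l, (d l : ℝ) * x₀ ^ d l * S l 1 1))
              - μ * ((∑ l, x₀ ^ d l * S l 0 0) + (∑ l, x₀ ^ d l * S l 1 1))) ^ 2) ∧
      (∀ μ : ℝ,
        ((∑ l, (d l : ℝ) * x₀ ^ d l * S l 0 0) - μ * (∑ l, x₀ ^ d l * S l 0 0))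
            * ((∑ l, (d l : ℝ) * x₀ ^ d l * S l 1 1) - μ * (∑ l, x₀ ^ d l * S l 1 1))
          - ((∑ l, (d l : ℝ) * x₀ ^ d l * S l 0 1) - μ * (∑ l, x₀ ^ d l * S l 0 1)) ^ 2 ≤ 0) ∧
      ((∑ l, (d l : ℝ) * x₀ ^ d l * S l 0 0) * (∑ l, x₀ ^ d l * S l 1 1)
          + (∑ l, x₀ ^ d l * S l 0 0) * (∑ l, (d l : ℝ) * x₀ ^ d l * S l 1 1)
          - 2 * (∑ l, x₀ ^ d l * S l 0 1) * (∑ l, (d l : ℝ) * x₀ ^ d l * S l 0 1)) ^ 2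
        ≤ 4 * ((∑ l, x₀ ^ d l * S l 0 0) * (∑ l, x₀ ^ d l * S l 1 1) - (∑ l, x₀ ^ d l * S l 0 1) ^ 2)
            * ((∑ l, (d l : ℝ) * x₀ ^ d l * S l 0 0) * (∑ l, (d l : ℝ) * x₀ ^ d l * S l 1 1)
                - (∑ l, (d l : ℝ) * x₀ ^ d l * S l 0 1) ^ 2) ∧
      (∑ l, (d l : ℝ) * x₀ ^ d l * S l 0 0) * (∑ l, (d l : ℝ) * x₀ ^ d l * S l 1 1)
          - (∑ l, (d l : ℝ) * x₀ ^ d l * S l 0 1) ^ 2 ≤ 0 := by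
  -- apply the positive-type theorem to the negated letters
  have e1 : ∀ (x : ℝ) (i j : Fin 2), (∑ l, x ^ d l * (-S l) i j) = -(∑ l, x ^ d l * S l i j) := by
    intro x i j; rw [← Finset.sum_neg_distrib]; exact Finset.sum_congr rfl fun l _ => by simp [Matrix.neg_apply]
  have e2 : ∀ (x : ℝ) (i j : Fin 2), (∑ l, (d l : ℝ) * x ^ d l * (-S l) i j) = -(∑ l, (d l : ℝ) * x ^ d l * S l i j) := by
    intro x i j; rw [← Finset.sum_neg_distrib]; exact Finset.sum_congr rfl fun l _ => by simp [Matrix.neg_apply]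
  obtain ⟨x₀, hx₀, -, h1, h2, h3, h4⟩ := exteriorTangent_pencil d (fun l => -S l) hα hαβ
    (by simp only [e1]; linarith) (by simp only [e1]; linarith)
    (fun x hx => by simp only [e1]; nlinarith [hneg x hx]) (by simp only [e1]; linarith) (by simp only [e1]; linarith)
  simp only [e1, e2] at h1 h2 h3 h4
  refine ⟨x₀, hx₀, fun μ => ?_, fun μ => ?_, ?_, ?_⟩
  · have := h1 μ; nlinarith [this]
  · have := h2 μ; nlinarith [this]
  · nlinarith [h3]
  · nlinarith [h4]

/-- **EXTERIOR-TANGENT LAW, MATRIX FORM FROM ROOT DATA.**  Let `F(x) = Σ_l x^{d_l} • S_l` be a real symmetric `2 × 2` pencil (any length,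
any support), `0 < α < β` two det-roots with no det-root strictly between, `det F(m) < 0` at one point `m ∈ (α, β)`, and
`tr F(α) · tr F(β) > 0` (a return excursion, positive OR negative type).  Then some `x₀ ∈ (α, β)` carries the exterior-tangent rows
for `F₀ = F(x₀)` and the Euler pencil `E₀ = Σ_l (d_l x₀^{d_l}) • S_l`. [folklore] -/
theorem exteriorTangent_matrix (d : Fin K → ℕ) (S : Fin K → Matrix (Fin 2) (Fin 2) ℝ) (hS : ∀ l, (S l).IsSymm)
    {α β m : ℝ} (hα : 0 < α) (hαβ : α < β)
    (hfα : (∑ l, α ^ d l • S l).det = 0) (hfβ : (∑ l, β ^ d l • S l).det = 0)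
    (hnz : ∀ x ∈ Ioo α β, (∑ l, x ^ d l • S l).det ≠ 0)
    (hm : m ∈ Ioo α β) (hmneg : (∑ l, m ^ d l • S l).det < 0)
    (hT : 0 < (∑ l, α ^ d l • S l).trace * (∑ l, β ^ d l • S l).trace) :
    ∃ x₀ ∈ Ioo α β,
      (∀ μ : ℝ, ((∑ l, ((d l : ℝ) * x₀ ^ d l) • S l) - μ • (∑ l, x₀ ^ d l • S l)).det
            * ((∑ l, x₀ ^ d l • S l).trace) ^ 2
          ≤ (∑ l, x₀ ^ d l • S l).det
            * (((∑ l, ((d l : ℝ) * x₀ ^ d l) • S l) - μ • (∑ l, x₀ ^ d l • S l)).trace) ^ 2) ∧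
      (∀ μ : ℝ, ((∑ l, ((d l : ℝ) * x₀ ^ d l) • S l) - μ • (∑ l, x₀ ^ d l • S l)).det ≤ 0) ∧
      ((∑ l, x₀ ^ d l • S l) 0 0 * (∑ l, ((d l : ℝ) * x₀ ^ d l) • S l) 1 1
          + (∑ l, x₀ ^ d l • S l) 1 1 * (∑ l, ((d l : ℝ) * x₀ ^ d l) • S l) 0 0
          - 2 * (∑ l, x₀ ^ d l • S l) 0 1 * (∑ l, ((d l : ℝ) * x₀ ^ d l) • S l) 0 1) ^ 2
        ≤ 4 * (∑ l, x₀ ^ d l • S l).det * (∑ l, ((d l : ℝ) * x₀ ^ d l) • S l).det ∧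
      (∑ l, x₀ ^ d l • S l).det < 0 ∧ (∑ l, ((d l : ℝ) * x₀ ^ d l) • S l).det ≤ 0 := by
  -- the determinant is negative on the whole gap (no root inside, negative at `m`): intermediate value theorem
  obtain ⟨p, hp⟩ : ∃ p : Polynomial ℝ, p = (∑ l, (Polynomial.X : Polynomial ℝ) ^ d l • (S l).map Polynomial.C).det := ⟨_, rfl⟩
  have hpev : ∀ x, p.eval x = (∑ l, x ^ d l • S l).det := fun x => by
    rw [hp]; exact SymmetroidDescartes.eval_det_pencil S d x
  have hneg : ∀ x ∈ Ioo α β, (∑ l, x ^ d l • S l).det < 0 := by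
    intro x hx
    rcases lt_trichotomy ((∑ l, x ^ d l • S l).det) 0 with h | h | h
    · exact h
    · exact absurd h (hnz x hx)
    · exfalso
      -- a root between `x` and `m`
      rcases lt_or_gt_of_ne (show x ≠ m from fun hxm => by rw [hxm] at h; linarith) with hxm | hxm
      · obtain ⟨z, hz, hz0⟩ := intermediate_value_Ioo' hxm.le (p.continuous.continuousOn)
          (show p.eval m < 0 ∧ 0 < p.eval x from ⟨by rw [hpev]; exact hmneg, by rw [hpev]; exact h⟩)
        exact hnz z ⟨lt_trans hx.1 hz.1, lt_trans hz.2 hm.2⟩ (by rw [← hpev]; exact hz0)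
      · obtain ⟨z, hz, hz0⟩ := intermediate_value_Ioo hxm.le (p.continuous.continuousOn)
          (show p.eval m < 0 ∧ 0 < p.eval x from ⟨by rw [hpev]; exact hmneg, by rw [hpev]; exact h⟩)
        exact hnz z ⟨lt_trans hm.1 hz.1, lt_trans hz.2 hx.2⟩ (by rw [← hpev]; exact hz0)
  -- entry-sum forms of the hypotheses
  have hfα' := hfα; have hfβ' := hfβ
  rw [det_pencilTwo d S hS] at hfα' hfβ'
  have hneg' : ∀ x ∈ Ioo α β,
      (∑ l, x ^ d l * S l 0 0) * (∑ l, x ^ d l * S l 1 1) - (∑ l, x ^ d l * S l 0 1) ^ 2 < 0 := by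
    intro x hx; have := hneg x hx; rwa [det_pencilTwo d S hS] at this
  rw [trace_pencilTwo, trace_pencilTwo] at hT
  -- both traces positive, or both negative
  rcases lt_or_gt_of_ne (show (∑ l, α ^ d l * S l 0 0) + (∑ l, α ^ d l * S l 1 1) ≠ 0 from
      fun h0 => by rw [h0, zero_mul] at hT; exact lt_irrefl _ hT) with hTα | hTα
  · have hTβ : (∑ l, β ^ d l * S l 0 0) + (∑ l, β ^ d l * S l 1 1) < 0 := by
      by_contra hc; push Not at hc
      have := mul_nonpos_of_nonpos_of_nonneg hTα.le hc
      linarith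
    obtain ⟨x₀, hx₀, h1, h2, h3, h4⟩ := exteriorTangent_pencil_neg d S hα hαβ hfα' hfβ' hneg' hTα hTβ
    refine ⟨x₀, hx₀, fun μ => ?_, fun μ => ?_, ?_, hneg x₀ hx₀, ?_⟩
    · rw [det_eulerPencilTwo_sub_smul d S hS, trace_pencilTwo, det_pencilTwo d S hS, trace_eulerPencilTwo_sub_smul]
      exact h1 μ
    · rw [det_eulerPencilTwo_sub_smul d S hS]; exact h2 μ
    · rw [det_pencilTwo d S hS, det_eulerPencilTwo d S hS, pencilTwo_apply, pencilTwo_apply, pencilTwo_apply,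
        eulerPencilTwo_apply, eulerPencilTwo_apply, eulerPencilTwo_apply]
      nlinarith [h3]
    · rw [det_eulerPencilTwo d S hS]; exact h4
  · have hTβ : 0 < (∑ l, β ^ d l * S l 0 0) + (∑ l, β ^ d l * S l 1 1) := by
      by_contra hc; push Not at hc
      have := mul_nonpos_of_nonneg_of_nonpos hTα.le hc
      linarith
    obtain ⟨x₀, hx₀, -, h1, h2, h3, h4⟩ := exteriorTangent_pencil d S hα hαβ hfα' hfβ' hneg' hTα hTβ
    refine ⟨x₀, hx₀, fun μ => ?_, fun μ => ?_, ?_, hneg x₀ hx₀, ?_⟩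
    · rw [det_eulerPencilTwo_sub_smul d S hS, trace_pencilTwo, det_pencilTwo d S hS, trace_eulerPencilTwo_sub_smul]
      exact h1 μ
    · rw [det_eulerPencilTwo_sub_smul d S hS]; exact h2 μ
    · rw [det_pencilTwo d S hS, det_eulerPencilTwo d S hS, pencilTwo_apply, pencilTwo_apply, pencilTwo_apply,
        eulerPencilTwo_apply, eulerPencilTwo_apply, eulerPencilTwo_apply]
      nlinarith [h3]
    · rw [det_eulerPencilTwo d S hS]; exact h4

end Roots

end Summit.ValiantsHypothesis.ValiantsHypothesis.Theorems.LacunarySymmetroidMatrixDescartes.Census
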